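import Literature.MathematicalPhysics.QuantumFieldTheory.Balaban1983to89.B13OpsYPencilGreen
import Literature.MathematicalPhysics.QuantumFieldTheory.Balaban1983to89.B13DirichletLocalInverseLetters
import Literature.MathematicalPhysics.QuantumFieldTheory.Balaban1983to89.Node00.OpsYDeltaALocal

/-!
# `Balaban1983to89.B13DirichletLocalDeltaALetters` — T. Bałaban, *Propagators for lattice gauge theories in a background field*, Commun. Math. Phys. **99**
(1985) 389–434 [Balaban1985BackgroundPropagators], (3.3) p. 391 and (3.8) p. 392 (`D_U`, `D*_U`), (3.25)–(3.26) pp. 394–395 («Δ_a(U) = Δ(U) + D_U R(U) D\*_U + Q\*(U)aQ(U)»),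
(3.105) p. 414 (the local gauge projection `P_□` and `DP_□D*`), Sect. C pp. 408–409 («G′_□(U), C_□(U) = (Q′(U)G′_□²(U)Q′\*(U))⁻¹, G_□(U)»), Thm 3.4 p. 400,
Thm 3.10 (3.107)–(3.108) p. 416; *Renormalization group approach to lattice gauge field theories. II*, Commun. Math. Phys. **116** (1988) 1–22 [Balaban1988RG2Cluster]
(2.5)–(2.7) pp. 12–13, p. 15: STATION L4 OF THE LOCAL-CUBE ROAD — node00-def-Y's LOCALISED operator `Δ_{a,□}(U) = Δ(U) + D_U R_□(U) D*_U + Q*aQ`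
(`Node00.OpsYDeltaALocal.deltaALocY`, formula (3.26) with the local projection `R_□`) and its Dirichlet compression `padDeltaALocY = P_χ Δ_{a,□} P_χ + (1 − P_χ)` in the
N10 entry-letter currency along pv27's pencil `A′ ↦ e^{iηA′}U₀`, from the R_□-station's output and the local part's letters.

statement-level bookkeeping over LANDED theorems with citation tags; kernel-checked; letter algebra by name; nothing here is a claim about the Yang–Mills mass gap;
nothing of Bałaban's operators is asserted; no node is discharged; count-neutral.

WHY THIS FILE (cell `pub-ymgap`, HUMAN RULING D-0062, Track A node N10 = [Balaban1988RG2Cluster] → N06 row 17; width seat `pub-ymgap-dag-n10-w3` g5, road declarer;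
lane fan-out dag-n10-c g16 2026-08-28: L1 `B13DirichletLocalInverseLetters` (w3) · L2 `C_□` (w5) · L3 `R_□` (w6, `B13DirichletLocalRProjLetters`) · L4 + L5 (w3)).  This is
dag-n10-w2 g2's Δ_a assembly (`B13OpsYPencilGreen` §2–§3: `rawEntryLetters_toMatrix_DRD_prodCfg`, `…deltaAY_prodCfg`) RE-ISSUED with the middle factor GENERIC and then
instantiated at def-Y's LOCAL projection `R_□ = RlocY`: w2's `D_U ∕ D*_U` transporter facts (§1 of their file) sandwich ANY site-sector letters family without rate loss; with
L3's output `hR` (letters of `a ↦ toMatrix(R_□(e^{iηa}U₀))`, DISPLAYED — the lane's rule «each station's output binder is the next station's input binder verbatim») and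
the local part's letters `hLoc` (76 ∕ dag-n10-w4's located editions, DISPLAYED) this gives `Δ_{a,□}`'s letters; L1 §1 then compresses them by the bond cut `χ` (the padded
operator of dag-n06-j's `hloc` slot).  L5 (`B13DirichletLocalCoerciveBall`) feeds the result to module 83.

WHAT THIS FILE PROVES (all `theorem`s; no `def`, no instance, no notation).
§1 ★ `rawEntryLetters_toMatrix_gradMdiv_prodCfg` — `a ↦ toMatrix(D_U)·M(a)·toMatrix(D*_U)` at `U = e^{iηa}U₀` has letters `(R, ρ, a_D·b_D·B_M·e^{2ρr′})` for ANY
   site-sector family `M` with letters `(R, ρ, B_M)` (w2 g2's `…DRD_prodCfg` with `toMatrix(R(U))` replaced by `M(a)`; same proof: one 56A `rawEntryLetters_sandwich_family`).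
§2 `toMatrix_deltaALocY_eq` (`toMatrix(Δ_{a,□}(U)) = toMatrix(Δ(U) + Q*aQ(U)) + toMatrix(D_U)·toMatrix(R_□(U))·toMatrix(D*_U)`), ★★ `rawEntryLetters_toMatrix_deltaALocY_prodCfg`
   (ANY `parS parB D P U₀`, any basis `b` of `𝔸`: `hR` + `hLoc` ⟹ letters of `a ↦ toMatrix (Δ_{a,□}(e^{iηa}U₀))`, constant `B_L + a_D·b_D·B_R·e^{2ρr′}`).
§3 (`𝔸 = M_N(ℂ)`, matrix units) ★★ `rawEntryLetters_toMatrix_padDeltaALocY_prodCfg` (+ a 0∕1 bond cut `χ`: letters of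
   `a ↦ toMatrix (padDeltaALocY i parS parB D P (cutMulY χ) (e^{iηa}U₀))`, constant `+ 1` — L1 §1 `rawEntryLetters_toMatrix_dirPadY`; L5's input shape).
HONEST FRAMING: count-neutral Literature helper; `hR` (L3's output, hence L1∕L2's content) and `hLoc` DISPLAYED, not proved here; no decay ∕ invertibility ∕ coercivity
asserted; chart ball, NOT (3.35); N06 ∕ N10 NOT discharged; no registered stub proved; counts unmoved; one finite 𝕋⁴ programme at fixed ε — R4 closes the conditional
finite-𝕋⁴ rung `BalabanLadder.UV` only; nothing continuum ∕ ℝ⁴ ∕ OS ∕ mass gap ∕ Clay.  0 `sorry`, 0 `def`, standard axioms.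

References: [Balaban1985BackgroundPropagators] (3.3) p.391, (3.8) p.392, (3.25)–(3.27) pp.394–395, Thm 3.4 p.400, (3.84)–(3.86) p.407, Sect. C pp.408–409, (3.105) p.414,
Thm 3.10 (3.107)–(3.108) pp.415–416; [Balaban1988RG2Cluster] (2.5)–(2.7) pp.12–13, p.15; [Balaban1984PropagatorsII] (2.54) p.232, Lemma 2.1 (2.61) p.234.
-/

noncomputable section

namespace Literature.MathematicalPhysics.QuantumFieldTheory.Balaban1983to89.B13DirichletLocalDeltaALetters

open Metric Set Finset Module
open scoped Matrix
open Literature.MathematicalPhysics.QuantumFieldTheory.Balaban1983to89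
open Literature.MathematicalPhysics.QuantumFieldTheory.Balaban1983to89.B9Thm37GlueTorus (tdist1)
open Literature.MathematicalPhysics.QuantumFieldTheory.Balaban1983to89.B5TorusCover (UT)
open Literature.MathematicalPhysics.QuantumFieldTheory.Balaban1983to89.B13EntrywiseWalks (RawEntryLetters)
open Literature.MathematicalPhysics.QuantumFieldTheory.Balaban1983to89.B13EntryLetterAlgebra (rawEntryLetters_mono rawEntryLetters_congr rawEntryLetters_add)
open Literature.MathematicalPhysics.QuantumFieldTheory.Balaban1983to89.B13EntryLetterAlgebraFamily (rawEntryLetters_sandwich_family)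
open Literature.MathematicalPhysics.QuantumFieldTheory.Balaban1983to89.B13OpsYPencilGreen
  (differentiableOn_toMatrix_gradY_prodCfg tdist_le_of_toMatrix_gradY_ne_zero rowSum_toMatrix_gradY_prodCfg_le
    differentiableOn_toMatrix_divY_prodCfg tdist_le_of_toMatrix_divY_ne_zero colSum_toMatrix_divY_prodCfg_le)
open Literature.MathematicalPhysics.QuantumFieldTheory.Balaban1983to89.B13DirichletLocalInverseLetters (rawEntryLetters_toMatrix_dirPadY)
open Literature.MathematicalPhysics.QuantumFieldTheory.Balaban1983to89.B9Thm37CubeCoverCommutators (cutMulY)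
open Literature.MathematicalPhysics.QuantumFieldTheory.Balaban1983to89.B9Eq39Adjoint (prodCfg)
open Literature.MathematicalPhysics.QuantumFieldTheory.Balaban1983to89.B6GlobalChartV1 (PV)
open Literature.MathematicalPhysics.QuantumFieldTheory.Balaban1983to89.B6KLevelCensusIndexV1 (KIdx)
open Literature.MathematicalPhysics.QuantumFieldTheory.Balaban1983to89.Node00
open Literature.MathematicalPhysics.QuantumFieldTheory.Balaban1983to89.Node00.OpsYLocalInverse (dirPadY)
open Literature.MathematicalPhysics.QuantumFieldTheory.Balaban1983to89.Node00.OpsYDeltaALocal (RlocY deltaALocY padDeltaALocY)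

variable {𝔸 : Type} [NormedRing 𝔸] [NormedAlgebra ℂ 𝔸] [CompleteSpace 𝔸]
variable {d ℓ : ℕ} {hd : 1 ≤ d + 1} {hL : Odd (ℓ + 1) ∧ 1 < ℓ + 1} {b₀ b₁ : ℝ}
variable (i : KIdx d ℓ hd hL b₀ b₁)
variable {κ : Type} [Fintype κ] [DecidableEq κ] (b : Basis κ ℂ 𝔸)
variable (U₀ : CfgY 𝔸 i) (η : ℝ) {Rd K₀ : ℝ}
variable [DecidableEq (SiteY i)] [DecidableEq (FBondY i)]

/-! ## §1. ★ `D_U · M · D*_U` along the pencil for ANY site-sector letters family `M` -/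

section Sandwich

variable [NormOneClass 𝔸]
variable {ν : ℕ} {Nf : Fin ν → ℕ} [∀ j, NeZero (Nf j)]

/-- ★ **`D_U · M(a) · D*_U` ALONG THE PENCIL, MIDDLE FACTOR GENERIC** (dag-n10-w2 g2's `B13OpsYPencilGreen.rawEntryLetters_toMatrix_DRD_prodCfg` with `toMatrix(R(U))` replaced by an
arbitrary site-sector matrix family `M(a)` with letters `(R, ρ, B_M)` on `ℓS ∘ fst`): (D′)'s sandwich by the local rectangular families `toMatrix(D_U) ∕ toMatrix(D*_U)` at
`U = e^{iηa}U₀` (w2's §1 facts: numerals `K₀`, `CgR, CdC ≥ 0`, reading `r′`, basis numerals) — NO rate loss, `RawEntryLetters (a ↦ toMatrix(D_U)·M(a)·toMatrix(D*_U)) (ℓF ∘ fst) R ρ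
(a_D·b_D·B_M·e^{2ρr′})`.  Proof = w2's, verbatim (one application of 56A `rawEntryLetters_sandwich_family`).
[cite: Balaban1985BackgroundPropagators, (3.3) p.391, (3.8) p.392, (3.26) p.395, Thm 3.4 p.400, (3.84)–(3.86) p.407; Balaban1988RG2Cluster, (2.5)–(2.6) p.12; Balaban1984PropagatorsII, (2.54) p.232] -/
theorem rawEntryLetters_toMatrix_gradMdiv_prodCfg
    (hU : ∀ μ x, ‖(U₀ μ x : 𝔸)‖ ≤ K₀) (hUi : ∀ μ x, ‖(((U₀ μ x)⁻¹ : 𝔸ˣ) : 𝔸)‖ ≤ K₀) (hK1 : 1 ≤ K₀) (hR0 : 0 ≤ Rd)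
    {CgR CdC : ℝ} (hCgR0 : 0 ≤ CgR) (hCgR : ∀ bb, ∑ z, |gradK i bb z| ≤ CgR) (hCdC0 : 0 ≤ CdC) (hCdC : ∀ bb, ∑ z, |divK i z bb| ≤ CdC)
    {cb cl : ℝ} (hcb : ∀ (x : 𝔸) (k : κ), ‖b.repr x k‖ ≤ cb * ‖x‖) (hcb0 : 0 ≤ cb) (hcl : ∀ l, ‖b l‖ ≤ cl) (hcl0 : 0 ≤ cl)
    (ℓS : SiteY i → UT Nf) (ℓF : FBondY i → UT Nf) {r' : ℝ}
    (hℓG : ∀ bb z, gradK i bb z ≠ 0 → tdist1 Nf (ℓF bb) (ℓS z) ≤ r') (hℓD : ∀ z bb, divK i z bb ≠ 0 → tdist1 Nf (ℓS z) (ℓF bb) ≤ r')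
    {ρ BM : ℝ} (hρ : 0 ≤ ρ)
    {M : (Fin (d + 1) → Site (PV d ℓ i.m i.K hd hL) 0 → 𝔸) → Matrix (SiteY i × κ) (SiteY i × κ) ℂ}
    (hM : RawEntryLetters M (fun q : SiteY i × κ => ℓS q.1) Rd ρ BM) :
    RawEntryLetters (fun a : Fin (d + 1) → Site (PV d ℓ i.m i.K hd hL) 0 → 𝔸 =>
        LinearMap.toMatrix ((Pi.basis fun _ : SiteY i => b).reindex (Equiv.sigmaEquivProd (SiteY i) κ))
            ((Pi.basis fun _ : FBondY i => b).reindex (Equiv.sigmaEquivProd (FBondY i) κ)) (gradY i (prodCfg U₀ η a)) *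
          M a *
          LinearMap.toMatrix ((Pi.basis fun _ : FBondY i => b).reindex (Equiv.sigmaEquivProd (FBondY i) κ))
            ((Pi.basis fun _ : SiteY i => b).reindex (Equiv.sigmaEquivProd (SiteY i) κ)) (divY i (prodCfg U₀ η a)))
      (fun p : FBondY i × κ => ℓF p.1) Rd ρ
      (CgR * (Fintype.card κ) * (cb * (K₀ * Real.exp (|η| * Rd) * cl * (K₀ * Real.exp (|η| * Rd)))) *
        (CdC * (Fintype.card κ) * (cb * (K₀ * Real.exp (|η| * Rd) * cl * (K₀ * Real.exp (|η| * Rd))))) * BM * Real.exp (2 * ρ * r')) := by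
  -- w2 g2's proof of `rawEntryLetters_toMatrix_DRD_prodCfg`, with `hR` replaced by `hM`
  have hK : 0 ≤ K₀ * Real.exp (|η| * Rd) := mul_nonneg (zero_le_one.trans hK1) (Real.exp_nonneg _)
  have hc0 : 0 ≤ cb * (K₀ * Real.exp (|η| * Rd) * cl * (K₀ * Real.exp (|η| * Rd))) := mul_nonneg hcb0 (mul_nonneg (mul_nonneg hK hcl0) hK)
  have ha0 : 0 ≤ CgR * (Fintype.card κ) * (cb * (K₀ * Real.exp (|η| * Rd) * cl * (K₀ * Real.exp (|η| * Rd)))) :=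
    mul_nonneg (mul_nonneg hCgR0 (Nat.cast_nonneg _)) hc0
  have hb0 : 0 ≤ CdC * (Fintype.card κ) * (cb * (K₀ * Real.exp (|η| * Rd) * cl * (K₀ * Real.exp (|η| * Rd)))) :=
    mul_nonneg (mul_nonneg hCdC0 (Nat.cast_nonneg _)) hc0
  exact rawEntryLetters_sandwich_family (locp := fun p : FBondY i × κ => ℓF p.1) hM hρ
    (A := fun a => LinearMap.toMatrix ((Pi.basis fun _ : SiteY i => b).reindex (Equiv.sigmaEquivProd (SiteY i) κ))
        ((Pi.basis fun _ : FBondY i => b).reindex (Equiv.sigmaEquivProd (FBondY i) κ)) (gradY i (prodCfg U₀ η a)))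
    (B' := fun a => LinearMap.toMatrix ((Pi.basis fun _ : FBondY i => b).reindex (Equiv.sigmaEquivProd (FBondY i) κ))
        ((Pi.basis fun _ : SiteY i => b).reindex (Equiv.sigmaEquivProd (SiteY i) κ)) (divY i (prodCfg U₀ η a)))
    (r := r') ha0 hb0
    (fun p q => differentiableOn_toMatrix_gradY_prodCfg i b U₀ η hcb p q)
    (fun a _ p q hne => tdist_le_of_toMatrix_gradY_ne_zero i b ℓS ℓF hℓG (prodCfg U₀ η a) p q hne)
    (fun a ha p => rowSum_toMatrix_gradY_prodCfg_le i b U₀ η hU hUi hK1 hR0 hcb hcb0 hcl hcl0 hCgR ha p)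
    (fun q p => differentiableOn_toMatrix_divY_prodCfg i b U₀ η hcb q p)
    (fun a _ q p hne => tdist_le_of_toMatrix_divY_ne_zero i b ℓS ℓF hℓD (prodCfg U₀ η a) q p hne)
    (fun a ha p => colSum_toMatrix_divY_prodCfg_le i b U₀ η hU hUi hK1 hR0 hcb hcb0 hcl hcl0 hCdC ha p)

end Sandwich

/-! ## §2. ★★ `Δ_{a,□}(e^{iηa}U₀)` along the pencil from the R_□-station's output -/

section DeltaALoc

/-- The matrix of `Δ_{a,□}(U)` in the bond-sector product basis: `toMatrix(Δ(U) + Q*aQ(U)) + toMatrix(D_U)·toMatrix(R_□(U))·toMatrix(D*_U)`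
(definition `deltaALocY = hessY + gradY ∘ RlocY ∘ divY + QsY ∘ aY ∘ QY` — (3.26) with `R ↦ R_□`; linearity, `LinearMap.toMatrix_comp`).
[cite: Balaban1985BackgroundPropagators, (3.26) p.395, (3.105) p.414] -/
theorem toMatrix_deltaALocY_eq (parS : SiteParY 𝔸 i) (parB : BondParY 𝔸 i) (D : Finset (SiteY i)) (P : Module.End ℂ (BlkY i → 𝔸)) (U : CfgY 𝔸 i) :
    LinearMap.toMatrix ((Pi.basis fun _ : FBondY i => b).reindex (Equiv.sigmaEquivProd (FBondY i) κ))
      ((Pi.basis fun _ : FBondY i => b).reindex (Equiv.sigmaEquivProd (FBondY i) κ)) (deltaALocY i parS parB D P U) =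
    LinearMap.toMatrix ((Pi.basis fun _ : FBondY i => b).reindex (Equiv.sigmaEquivProd (FBondY i) κ))
        ((Pi.basis fun _ : FBondY i => b).reindex (Equiv.sigmaEquivProd (FBondY i) κ)) (hessY i U + QsY i parB U ∘ₗ aY i ∘ₗ QY i parB U) +
      LinearMap.toMatrix ((Pi.basis fun _ : SiteY i => b).reindex (Equiv.sigmaEquivProd (SiteY i) κ))
          ((Pi.basis fun _ : FBondY i => b).reindex (Equiv.sigmaEquivProd (FBondY i) κ)) (gradY i U) *
        LinearMap.toMatrix ((Pi.basis fun _ : SiteY i => b).reindex (Equiv.sigmaEquivProd (SiteY i) κ))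
          ((Pi.basis fun _ : SiteY i => b).reindex (Equiv.sigmaEquivProd (SiteY i) κ)) (RlocY i parS D P U) *
        LinearMap.toMatrix ((Pi.basis fun _ : FBondY i => b).reindex (Equiv.sigmaEquivProd (FBondY i) κ))
          ((Pi.basis fun _ : SiteY i => b).reindex (Equiv.sigmaEquivProd (SiteY i) κ)) (divY i U) := by
  have hΔ : deltaALocY i parS parB D P U = (hessY i U + QsY i parB U ∘ₗ aY i ∘ₗ QY i parB U) + gradY i U ∘ₗ (RlocY i parS D P U ∘ₗ divY i U) := by
    rw [deltaALocY, add_right_comm]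
  rw [hΔ, map_add, LinearMap.toMatrix_comp _ ((Pi.basis fun _ : SiteY i => b).reindex (Equiv.sigmaEquivProd (SiteY i) κ)),
    LinearMap.toMatrix_comp _ ((Pi.basis fun _ : SiteY i => b).reindex (Equiv.sigmaEquivProd (SiteY i) κ)), Matrix.mul_assoc]

variable [NormOneClass 𝔸]
variable {ν : ℕ} {Nf : Fin ν → ℕ} [∀ j, NeZero (Nf j)]

/-- ★★ **`Δ_{a,□}(e^{iηa}U₀)` IN N10 COORDINATES** (ANY `parS parB`, site set `D`, block cut `P`, background `U₀`, basis `b`): from the R_□-station's output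
`hR : RawEntryLetters (a ↦ toMatrix (R_□(e^{iηa}U₀))) (ℓS ∘ fst) R ρ B_R` (station L3, DISPLAYED) and the local part's pencil letters
`hLoc : RawEntryLetters (a ↦ toMatrix (Δ(U) + Q*aQ(U))|_{U = e^{iηa}U₀}) (ℓF ∘ fst) R ρ B_L` (module 76, DISPLAYED), with w2's `D_U ∕ D*_U` numerals:
`RawEntryLetters (a ↦ toMatrix (Δ_{a,□}(e^{iηa}U₀))) (ℓF ∘ fst) R ρ (B_L + a_D·b_D·B_R·e^{2ρr′})` — §1 + 34 `rawEntryLetters_add` + `toMatrix_deltaALocY_eq`.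
[cite: Balaban1985BackgroundPropagators, (3.26) p.395, (3.105) p.414, Sect. C pp.408–409, Thm 3.4 p.400, (3.84) p.407, (3.108) p.416; Balaban1988RG2Cluster, (2.5)–(2.7) pp.12–13] -/
theorem rawEntryLetters_toMatrix_deltaALocY_prodCfg (parS : SiteParY 𝔸 i) (parB : BondParY 𝔸 i) (D : Finset (SiteY i)) (P : Module.End ℂ (BlkY i → 𝔸))
    (hU : ∀ μ x, ‖(U₀ μ x : 𝔸)‖ ≤ K₀) (hUi : ∀ μ x, ‖(((U₀ μ x)⁻¹ : 𝔸ˣ) : 𝔸)‖ ≤ K₀) (hK1 : 1 ≤ K₀) (hR0 : 0 ≤ Rd)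
    {CgR CdC : ℝ} (hCgR0 : 0 ≤ CgR) (hCgR : ∀ bb, ∑ z, |gradK i bb z| ≤ CgR) (hCdC0 : 0 ≤ CdC) (hCdC : ∀ bb, ∑ z, |divK i z bb| ≤ CdC)
    {cb cl : ℝ} (hcb : ∀ (x : 𝔸) (k : κ), ‖b.repr x k‖ ≤ cb * ‖x‖) (hcb0 : 0 ≤ cb) (hcl : ∀ l, ‖b l‖ ≤ cl) (hcl0 : 0 ≤ cl)
    (ℓS : SiteY i → UT Nf) (ℓF : FBondY i → UT Nf) {r' : ℝ}
    (hℓG : ∀ bb z, gradK i bb z ≠ 0 → tdist1 Nf (ℓF bb) (ℓS z) ≤ r') (hℓD : ∀ z bb, divK i z bb ≠ 0 → tdist1 Nf (ℓS z) (ℓF bb) ≤ r')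
    {ρ BR BL : ℝ} (hρ : 0 ≤ ρ)
    (hR : RawEntryLetters (fun a : Fin (d + 1) → Site (PV d ℓ i.m i.K hd hL) 0 → 𝔸 =>
      LinearMap.toMatrix ((Pi.basis fun _ : SiteY i => b).reindex (Equiv.sigmaEquivProd (SiteY i) κ))
        ((Pi.basis fun _ : SiteY i => b).reindex (Equiv.sigmaEquivProd (SiteY i) κ)) (RlocY i parS D P (prodCfg U₀ η a)))
      (fun q : SiteY i × κ => ℓS q.1) Rd ρ BR)
    (hLoc : RawEntryLetters (fun a : Fin (d + 1) → Site (PV d ℓ i.m i.K hd hL) 0 → 𝔸 =>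
      LinearMap.toMatrix ((Pi.basis fun _ : FBondY i => b).reindex (Equiv.sigmaEquivProd (FBondY i) κ))
        ((Pi.basis fun _ : FBondY i => b).reindex (Equiv.sigmaEquivProd (FBondY i) κ))
        (hessY i (prodCfg U₀ η a) + QsY i parB (prodCfg U₀ η a) ∘ₗ aY i ∘ₗ QY i parB (prodCfg U₀ η a)))
      (fun p : FBondY i × κ => ℓF p.1) Rd ρ BL) :
    RawEntryLetters (fun a : Fin (d + 1) → Site (PV d ℓ i.m i.K hd hL) 0 → 𝔸 =>
        LinearMap.toMatrix ((Pi.basis fun _ : FBondY i => b).reindex (Equiv.sigmaEquivProd (FBondY i) κ))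
          ((Pi.basis fun _ : FBondY i => b).reindex (Equiv.sigmaEquivProd (FBondY i) κ))
          (deltaALocY i parS parB D P (prodCfg U₀ η a)))
      (fun p : FBondY i × κ => ℓF p.1) Rd ρ
      (BL + CgR * (Fintype.card κ) * (cb * (K₀ * Real.exp (|η| * Rd) * cl * (K₀ * Real.exp (|η| * Rd)))) *
        (CdC * (Fintype.card κ) * (cb * (K₀ * Real.exp (|η| * Rd) * cl * (K₀ * Real.exp (|η| * Rd))))) * BR * Real.exp (2 * ρ * r')) := by
  have hDRD := rawEntryLetters_toMatrix_gradMdiv_prodCfg i b U₀ η hU hUi hK1 hR0 hCgR0 hCgR hCdC0 hCdC hcb hcb0 hcl hcl0 ℓS ℓF hℓG hℓD hρ hR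
  refine rawEntryLetters_congr (rawEntryLetters_add hLoc hDRD) fun a _ => ?_
  rw [toMatrix_deltaALocY_eq]

end DeltaALoc

/-! ## §3. ★★ The Dirichlet compression `padDeltaALocY` along the pencil (matrix units) — station L5's input -/

section Pad

open scoped Matrix.Norms.L2Operator

variable {N : ℕ}
variable {ν : ℕ} {Nf : Fin ν → ℕ} [∀ j, NeZero (Nf j)]

omit [DecidableEq (SiteY i)] in
/-- ★★ **`padDeltaALocY` ALONG THE PENCIL** (`𝔸 = M_N(ℂ)`, matrix units; ANY `parS parB D P U₀`, a 0∕1 BOND cut `χ`): from `Δ_{a,□}`'s pencil letters `(R, ρ, B)` (§2),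
`RawEntryLetters (a ↦ toMatrix (padDeltaALocY i parS parB D P (cutMulY χ) (e^{iηa}U₀))) loc R ρ (B + 1)` — `padDeltaALocY = dirPadY (cutMulY χ) Δ_{a,□}` (def-Y, `rfl`) and
L1 §1 `rawEntryLetters_toMatrix_dirPadY`.  This is the letters input `hA` of station L5 (module 83 at the compressed local operator).
[cite: Balaban1985BackgroundPropagators, Sect. C pp.408–409 (G_□(U)), (3.87) p.409, (3.108) p.416; Balaban1988RG2Cluster, (2.5) p.12] -/
theorem rawEntryLetters_toMatrix_padDeltaALocY_prodCfg (parS : SiteParY (Matrix (Fin N) (Fin N) ℂ) i)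
    (parB : BondParY (Matrix (Fin N) (Fin N) ℂ) i) (D : Finset (SiteY i)) (P : Module.End ℂ (BlkY i → Matrix (Fin N) (Fin N) ℂ))
    (U₀ : CfgY (Matrix (Fin N) (Fin N) ℂ) i) (η : ℝ) {loc : FBondY i × (Fin N × Fin N) → UT Nf} {R ρ B : ℝ}
    (hA : RawEntryLetters (fun a : Fin (d + 1) → Site (PV d ℓ i.m i.K hd hL) 0 → Matrix (Fin N) (Fin N) ℂ =>
      LinearMap.toMatrix
        ((Pi.basis fun _ : FBondY i => Matrix.stdBasis ℂ (Fin N) (Fin N)).reindex (Equiv.sigmaEquivProd (FBondY i) (Fin N × Fin N)))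
        ((Pi.basis fun _ : FBondY i => Matrix.stdBasis ℂ (Fin N) (Fin N)).reindex (Equiv.sigmaEquivProd (FBondY i) (Fin N × Fin N)))
        (deltaALocY i parS parB D P (prodCfg U₀ η a))) loc R ρ B)
    (hρ : 0 ≤ ρ) {χ : FBondY i → ℝ} (hχ : ∀ bb, χ bb = 0 ∨ χ bb = 1) :
    RawEntryLetters (fun a : Fin (d + 1) → Site (PV d ℓ i.m i.K hd hL) 0 → Matrix (Fin N) (Fin N) ℂ =>
        LinearMap.toMatrix
          ((Pi.basis fun _ : FBondY i => Matrix.stdBasis ℂ (Fin N) (Fin N)).reindex (Equiv.sigmaEquivProd (FBondY i) (Fin N × Fin N)))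
          ((Pi.basis fun _ : FBondY i => Matrix.stdBasis ℂ (Fin N) (Fin N)).reindex (Equiv.sigmaEquivProd (FBondY i) (Fin N × Fin N)))
          (padDeltaALocY i parS parB D P (cutMulY χ) (prodCfg U₀ η a))) loc R ρ (B + 1) :=
  -- `padDeltaALocY … = dirPadY (cutMulY χ) (deltaALocY …)` is `rfl`; the family argument is left to unification (L1's kernel note)
  rawEntryLetters_toMatrix_dirPadY hA hρ hχ

end Pad

end Literature.MathematicalPhysics.QuantumFieldTheory.Balaban1983to89.B13DirichletLocalDeltaALetters
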